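import Literature.AnabelianGeometry.EtaleTheta.Discharge.Sec5KummerOutReachedContinuous
import Literature.AnabelianGeometry.EtaleTheta.Discharge.Sec5KummerOutCanonical
import Literature.AnabelianGeometry.EtaleTheta.MonoThetaEnvPowers
import Literature.NumberTheory.GaloisRepresentations.KummerCocycleRepresentatives

/-!
# [EtTh] §5, Lemma 5.8 / 5.9 (iv): the two arithmetic inputs of the `K^×`-part of `D` FROM Hilbert 90 and one Galois dictionary of the constants (pp. 273, 331–332 / PDF pp. 47, 105–106)

Mochizuki, *The étale theta function and its Frobenioid-theoretic manifestations*, Publ. RIMS **45**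
(2009) [cite: MochizukiEtTh2009, Lem 5.8 p.331 (PDF p.105); Lem 5.9 (iv) p.332 (PDF p.106); Def 2.13 (i)
p.273 (PDF p.47)].  Layer L2 of the abc-iut cell, seat abc-iut-L2-t11 (gen 3); GAP-LEDGER rows G-L2t11-1
(`hgeom`) and G-L2t11-2 (`hKumC`, continuous form of abc-iut-L6-t23's `Sec5KummerOutReachedContinuous.lean`,
ruling of abc-iut-L2-lead 02:30:52Z).  PROOF-ONLY (no `def`, no structure, no `Prop` fact; nothing landed
is edited).

WHAT THIS FILE DOES.  The two hypotheses under which this seat certified Lemma 5.9 (iv) at the honest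
`K^×`-part `kummerOut ⊆ Out(E^Π_N)` (`Sec5KummerOutTransport.lean`, `Sec5KummerOutCanonical.lean`) were
* `hgeom` — "since `Y` is geometrically connected over `K` … `Π^tp_Y` [i.e., `G_K`, via the natural
  surjection `Π^tp_Y ↠ G_K`] acts [on `(K^×)^{1/N}`]" (proof of Lemma 5.8, p.331 (PDF p.105)): `Δ^tp_Y`
  fixes the `N`-th roots of constants;
* `hKumC` — "`K^× ↠ (K^×)/(K^×)^N ⥲ H¹(G_K, μ_N)` — where the '`⥲`' is the Kummer map" (Def. 2.13 (i),
  p.273 (PDF p.47)): every CONTINUOUS `μ_N`-valued `1`-cocycle of `G_K` is, up to a coboundary, the Kummer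
  cocycle of an `N`-th root of a constant — Kummer theory of `K`, i.e. Hilbert 90.
Both are consequences of ONE dictionary saying what the objects ARE at the genuine data, plus the tree's
Hilbert 90.  The dictionary (explicit binders, all of them identifications that hold by construction for
the [EtTh] §1/§2 model — abc-iut-L3-t2's `TemperedCurve` has `GK := K.fixingSubgroup ≤ Gal(ℚ̄_p/ℚ_p)`,
abc-iut-L2-t8's `thetaEnvData` has `G := GK`, `mu := μ_N(ℚ̄_p)`, `chi :=` the Galois action):
* an ARITHMETIC SIDE `F ⊆ L` (fields, `L/F` normal, `N` invertible in `F`; genuinely `F = K`, `L = ℚ̄_p`) and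
  `e : T.G ≃* Aut_F(L)` ("`G_K = Gal(K̄/K)`"; Mathlib `IntermediateField.fixingSubgroupEquiv`);
* `j : T.mu →* Lˣ`, injective, onto the `N`-torsion, `G_K`-equivariant (`μ_N = μ_N(K̄)` with its Galois
  action, p.270 (PDF p.44): "`Δ_{μ_N} := (ℤ/Nℤ)(1)`");
* `ν : (K^×)^{1/N} →* Lˣ` ("`(K^×)^{1/N} ⊆ O^×(B_N^birat)`", Lemma 5.8: the `N`-th roots of constants in the
  function field of `B_N` ARE algebraic over `K`, i.e. elements of `K̄`), compatible with `j ∘ m` on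
  `μ_N(B_N)`, EQUIVARIANT — the birational action of `s^⊓-gp_N(ρ(y))`, `y ∈ Π^tp_X̲`, on `(K^×)^{1/N}` is the
  Galois action of the image of `y` in `G_K` ("`Π^tp_Y` [i.e., `G_K` …] acts via multiplication by an
  element of `μ_N(B_N)`", p.331 (PDF p.105)) — and such that every constant of `F` has an `N`-th root in
  `(K^×)^{1/N}` (Lemma 5.8: "`(K^×)^{1/N}/μ_N(B_N) ⥲ K^×`");
* `Π^tp_Y ↠ G_K` is onto (`Y` geometrically connected) and OPEN onto the Krull topology (images of open
  subgroups of the tempered group are `G_{K'}`, `K'/K` finite).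
THEOREMS: `hgeom_of_galoisDictionary` (G-L2t11-1), `cyclotomicCharacterCompatX_of_galoisDictionary` (this seat's
gen-0 arithmetic fact also follows), `hroot_of_galoisDictionary` (the birational Kummer cocycle `κ_f`, read
through `(m, j)`, IS `σ ↦ σ(β)/β` for `β := ν f`), **`hKumC_of_hilbert90`** (G-L2t11-2 from the dictionary and
abc-iut-w5-d234's cocycle-level Kummer lemma `AlgEquiv.exists_kummer_eq_of_isOpen` over the tree's Hilbert 90 —
CONSUMED BY NAME, L2-lead ruling #3-R31), and Lemma 5.9 (iv) / "In particular" at the honest `K^×`-part and at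
`DK₀` with the arithmetic hypotheses `hinfl`/`hKum(C)`/`hχX`/`hgeom` of the earlier files REPLACED by the dictionary
(`envIsoBiTheta_birat_of_galoisDictionary`, `frdIsMonoThetaEnv_…`, `…_canonical_of_galoisDictionary`,
`D_kummerOut_eq_of_continuous`, `D_kummerOut_eq_of_galoisDictionary`).
HONEST FRAMING: kernel-checked implications over the typed §5/§2 interfaces; the dictionary binders are
hypotheses to be instantiated at the genuine data (merge row W3-L2-01), not facts; nothing of [EtTh] is
asserted unconditionally; typed ≠ proved; no side is taken on anything downstream ([IUTchIII] Cor. 3.12).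
-/

noncomputable section

namespace Literature.AnabelianGeometry.EtaleTheta

open CategoryTheory

universe w v v' u u'

namespace ThetaFrobenioid

variable {C : Type u} [Category.{v} C] {D : Type u'} [Category.{v'} D] {𝔉 : ThetaFrobenioid.{w} C D}

namespace BiratAutAction

variable (α : 𝔉.BiratAutAction) (hK : 𝔉.KxRootNModCyclotome)

/-! ### Two bookkeeping identities for the Kummer cocycle `κ_f` (proof of Lemma 5.8, p. 331) -/

/-- `κ_1 = 1`: the trivial root has trivial Kummer cocycle.
[cite: MochizukiEtTh2009, Lem 5.8 proof p.331 (PDF p.105)] -/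
theorem kummerCocycle_one_root (e : Aut 𝔉.BN) : α.kummerCocycle hK 1 e = 1 := by
  apply 𝔉.muToBirat_injective
  rw [α.muToBirat_kummerCocycle, OneMemClass.coe_one, map_one, mul_inv_cancel, map_one]

/-- `κ_{f⁻¹} = κ_f⁻¹` (`κ` is multiplicative in the root, `kummerCocycle_mul_root`).
[cite: MochizukiEtTh2009, Lem 5.8 proof p.331 (PDF p.105)] -/
theorem kummerCocycle_inv_root (f : 𝔉.KxRootN) (e : Aut 𝔉.BN) :
    α.kummerCocycle hK f⁻¹ e = (α.kummerCocycle hK f e)⁻¹ := by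
  rw [eq_inv_iff_mul_eq_one, ← α.kummerCocycle_mul_root hK f⁻¹ f e, inv_mul_cancel,
    α.kummerCocycle_one_root hK e]

/-! ### The Galois dictionary of the constants and its first consequences (Lemma 5.8, p. 331) -/

section Dictionary

variable (T : ThetaEnvData.{v} 𝔉.N) (ι : 𝔉.PiX ≃ₜ* T.PiX) (m : 𝔉.muTorsion 𝔉.BN 𝔉.N ≃* T.mu)
  {F : Type*} {L : Type*} [Field F] [Field L] [Algebra F L]
  (e : T.G ≃* (L ≃ₐ[F] L)) (j : T.mu →* Lˣ) (ν : 𝔉.KxRootN →* Lˣ)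

/-- **GAP row G-L2t11-1 (`hgeom`) FROM THE DICTIONARY**: if the birational action of `s^⊓-gp_N(ρ(y))` on
the `N`-th roots of constants `(K^×)^{1/N} ⊆ O^×(B_N^birat)` is, read in `K̄`, the Galois action of the image
of `y` in `G_K` (`hνeq`), then every `y ∈ Π^tp_Y̲` over `1 ∈ G_K` fixes `(K^×)^{1/N}` — print: "since `Y` is
geometrically connected over `K` … `Π^tp_Y` [i.e., `G_K`, via the natural surjection `Π^tp_Y ↠ G_K`] acts".
[cite: MochizukiEtTh2009, Lem 5.8 proof p.331 (PDF p.105)] -/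
theorem hgeom_of_galoisDictionary (hj : Function.Injective j)
    (hνeq : ∀ (f : 𝔉.KxRootN) (y : 𝔉.PiX),
      j (m (α.kummerCocycle hK f (𝔉.sgpCap (𝔉.ρ y)))) * ν f = e (T.aug (ι y)) • ν f)
    (f : 𝔉.KxRootN) (y : 𝔉.PiX) (_hy : y ∈ 𝔉.PiY) (haug : T.aug (ι y) = 1) :
    α.act (𝔉.sgpCap (𝔉.ρ y)) (f : 𝔉.biratUnits 𝔉.BN) = f := by
  have h := hνeq f y
  rw [haug, map_one, one_smul] at h
  have h1 : j (m (α.kummerCocycle hK f (𝔉.sgpCap (𝔉.ρ y)))) = 1 :=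
    mul_right_cancel (h.trans (one_mul _).symm)
  have hκ : α.kummerCocycle hK f (𝔉.sgpCap (𝔉.ρ y)) = 1 :=
    m.injective (hj (by rw [h1, map_one, map_one]))
  have h2 := α.muToBirat_kummerCocycle hK f (𝔉.sgpCap (𝔉.ρ y))
  rw [hκ, map_one] at h2
  exact mul_inv_eq_one.mp h2.symm

/-- **This seat's arithmetic fact `CyclotomicCharacterCompatX` (gen 0, `Sec5EnvelopeTopology.lean`) FROM THE
DICTIONARY**: conjugation by `s^⊓-gp_N(ρ(g))`, `g ∈ Π^tp_X̲`, on `μ_N(B_N)` is the cyclotomic character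
`χ(aug(ι g))` under `m` — because `μ_N(B_N) ⊆ (K^×)^{1/N}` (`muToBirat_mem_KxRootN`), on which the action is
the Galois action (`hνeq`), and `μ_N = μ_N(K̄)` Galois-equivariantly (`hchi`, `hνμ`).
[cite: MochizukiEtTh2009, Lem 5.8 proof p.331 (PDF p.105)] -/
theorem cyclotomicCharacterCompatX_of_galoisDictionary (hj : Function.Injective j)
    (hchi : ∀ (g : T.G) (x : T.mu), j (T.chi g x) = e g • j x)
    (hνμ : ∀ u : 𝔉.muTorsion 𝔉.BN 𝔉.N, ν ⟨𝔉.muToBirat u, 𝔉.muToBirat_mem_KxRootN u⟩ = j (m u))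
    (hνeq : ∀ (f : 𝔉.KxRootN) (y : 𝔉.PiX),
      j (m (α.kummerCocycle hK f (𝔉.sgpCap (𝔉.ρ y)))) * ν f = e (T.aug (ι y)) • ν f) :
    𝔉.CyclotomicCharacterCompatX T ι.toMulEquiv m := by
  intro g u u' hu'
  have hc : conjMu (𝔉.sgpCap (𝔉.ρ g)) u = u' := Subtype.ext hu'.symm
  -- the Kummer cocycle of the root `u ∈ μ_N(B_N) ⊆ (K^×)^{1/N}` at `s^⊓-gp_N(ρ g)` is `u' · u⁻¹`
  have hκ : α.kummerCocycle hK ⟨𝔉.muToBirat u, 𝔉.muToBirat_mem_KxRootN u⟩ (𝔉.sgpCap (𝔉.ρ g)) =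
      u' * u⁻¹ := by
    apply 𝔉.muToBirat_injective
    rw [α.muToBirat_kummerCocycle, map_mul, map_inv]
    change α.act (𝔉.sgpCap (𝔉.ρ g)) (𝔉.muToBirat u) * (𝔉.muToBirat u)⁻¹ = _
    rw [← α.muToBirat_conjMu, hc]
  have h := hνeq ⟨𝔉.muToBirat u, 𝔉.muToBirat_mem_KxRootN u⟩ g
  rw [hκ, hνμ, map_mul, map_inv, map_mul, map_inv, inv_mul_cancel_right, ← hchi] at h
  exact hj h

/-- **The birational Kummer cocycle IS the arithmetic one**: for every constant `y ∈ F^×` there are an `N`-th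
root `f ∈ (K^×)^{1/N} ⊆ O^×(B_N^birat)` and an `N`-th root `β ∈ K̄` of `y` such that the cocycle
`p ↦ m(κ_f(s^⊓-gp_N(ρ(ι⁻¹ p))))` of abc-iut-L2-t11's `kummerCocycleY`, read in `K̄^×` through `j`, is
`σ ↦ σ(β)/β`, `σ` the image of `p` in `G_K` — "the set of elements on which `Π^tp_Y` [i.e., `G_K` …] acts
via multiplication by an element of `μ_N(B_N)`" (proof of Lemma 5.8) read as Kummer theory.
[cite: MochizukiEtTh2009, Lem 5.8 proof p.331 (PDF p.105)] -/
theorem hroot_of_galoisDictionary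
    (hνeq : ∀ (f : 𝔉.KxRootN) (y : 𝔉.PiX),
      j (m (α.kummerCocycle hK f (𝔉.sgpCap (𝔉.ρ y)))) * ν f = e (T.aug (ι y)) • ν f)
    (hνN : ∀ y : Fˣ, ∃ f : 𝔉.KxRootN, ((ν f : Lˣ) : L) ^ (𝔉.N : ℕ) = algebraMap F L y) (y : Fˣ) :
    ∃ (f : 𝔉.KxRootN) (β : Lˣ), (β : L) ^ (𝔉.N : ℕ) = algebraMap F L y ∧
      ∀ p : T.PiY, j (α.kummerCocycleY hK f T ι.toMulEquiv m p) * β = e (T.augY p) • β := by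
  obtain ⟨f, hf⟩ := hνN y
  refine ⟨f, ν f, hf, fun p => ?_⟩
  have h := hνeq f (ι.toMulEquiv.symm (p : T.PiX))
  have e1 : ι (ι.toMulEquiv.symm (p : T.PiX)) = p := ι.toMulEquiv.apply_symm_apply _
  rw [e1] at h
  exact h

/-! ### G-L2t11-2: continuous Kummer surjectivity from Hilbert 90 (Def. 2.13 (i), p. 273: "the Kummer map") -/

/-- **GAP row G-L2t11-2 (`hKumC`, continuous form) FROM HILBERT 90 AND THE DICTIONARY.**  Every `μ_N`-valued
`1`-cocycle `δ₀` of `G_K` whose inflation to `Π^tp_Y` has a bi-continuous shift on `Π^tp_Y[μ_N]` (i.e. an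
element of abc-iut-L2-t2's `kummerOut`, Def. 2.13 (i)) is, up to a coboundary, the (inverse) Kummer cocycle
of an `N`-th root `f ∈ (K^×)^{1/N}` of a constant.  Print: "`K^× ↠ (K^×)/(K^×)^N ⥲ H¹(G_K, μ_N)` — where the
'`⥲`' is the Kummer map" (p.273 (PDF p.47)) and "`(K^×)^{1/N}/μ_N(B_N) ⥲ K^×`" (Lemma 5.8).  Proof: the shift
is bi-continuous, so `δ₀ ∘ (Π^tp_Y ↠ G_K)` is locally constant (abc-iut-L2-t2 lineage,
`ThetaEnvData.continuous_of_shift_mem`); `Π^tp_Y ↠ G_K` being onto and open, `σ ↦ j(δ₀(e⁻¹ σ))` is a Krull-locally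
constant `μ_N`-valued `1`-cocycle of `Aut_F(L)` in `L^×`, hence the Kummer cocycle `σ ↦ σ(x)/x` of an
`N`-th root `x` of a constant `a₀ ∈ F^×` (abc-iut-w5-d234's
`Literature.NumberTheory.GaloisRepresentations.AlgEquiv.exists_kummer_eq_of_isOpen` = Hilbert 90 + "`x^N` is
fixed" + Bezout, Serre *Local Fields* X §1 Prop. 2, §3 b), consumed BY NAME); an `N`-th root
`f ∈ (K^×)^{1/N}` of `a₀` has Kummer cocycle that of `ν f` (`hroot_of_galoisDictionary`), and
`x/ν f ∈ μ_N(K̄) = j(μ_N)` contributes a coboundary.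
[cite: MochizukiEtTh2009, Def 2.13 (i) p.273 (PDF p.47); Lem 5.8 p.331 (PDF p.105)] -/
theorem hKumC_of_hilbert90 [Normal F L] [NeZero ((𝔉.N : ℕ) : F)] (hj : Function.Injective j)
    (hjN : ∀ z : Lˣ, z ^ (𝔉.N : ℕ) = 1 → z ∈ j.range)
    (hchi : ∀ (g : T.G) (x : T.mu), j (T.chi g x) = e g • j x)
    (hνeq : ∀ (f : 𝔉.KxRootN) (y : 𝔉.PiX),
      j (m (α.kummerCocycle hK f (𝔉.sgpCap (𝔉.ρ y)))) * ν f = e (T.aug (ι y)) • ν f)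
    (hνN : ∀ y : Fˣ, ∃ f : 𝔉.KxRootN, ((ν f : Lˣ) : L) ^ (𝔉.N : ℕ) = algebraMap F L y)
    (haugY : Function.Surjective T.augY)
    (hopen : IsOpenMap fun p : T.PiY => e (T.augY p)) :
    ∀ (δ₀ : T.G → T.mu) (hδ : CycEnvelope.IsEnvCocycle T.augY T.chi (δ₀ ∘ T.augY)),
      CycEnvelope.shift hδ ∈ contMulAut T.env →
      ∃ (f : 𝔉.KxRootN) (a : T.mu), ∀ p : T.PiY,
        δ₀ (T.augY p) = (α.kummerCocycleY hK f T ι.toMulEquiv m p)⁻¹ *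
          CycEnvelope.coboundary T.augY T.chi a p := by
  intro δ₀ hδ hc
  -- (1) `δ₀` is a `1`-cocycle of `G_K` (its inflation is one and `Π^tp_Y ↠ G_K` is onto)
  have hcocG : ∀ g h : T.G, δ₀ (g * h) = δ₀ g * T.chi g (δ₀ h) := by
    intro g h
    obtain ⟨p, rfl⟩ := haugY g
    obtain ⟨q, rfl⟩ := haugY h
    rw [← map_mul]
    exact hδ p q
  -- (2) the cocycle `c σ := j (δ₀ (e⁻¹ σ))` of `Aut_F(L)` in `L^×`
  have hcc : ∀ σ τ : L ≃ₐ[F] L,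
      j (δ₀ (e.symm (σ * τ))) = σ • j (δ₀ (e.symm τ)) * j (δ₀ (e.symm σ)) := by
    intro σ τ
    rw [map_mul, hcocG, map_mul, hchi, MulEquiv.apply_symm_apply, mul_comm]
  -- (3) `{c = 1}` is Krull-open: it is the image of the open subgroup `{δ₀ ∘ aug = 1}` of `Π^tp_Y`
  have hcont : Continuous (δ₀ ∘ T.augY) := T.continuous_of_shift_mem hδ hc
  have hU : IsOpen ((δ₀ ∘ T.augY) ⁻¹' {1}) := hcont.isOpen_preimage _ (isOpen_discrete _)
  have hset : {σ : L ≃ₐ[F] L | j (δ₀ (e.symm σ)) = 1} =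
      (fun p : T.PiY => e (T.augY p)) '' ((δ₀ ∘ T.augY) ⁻¹' {1}) := by
    ext σ
    constructor
    · intro hσ
      obtain ⟨p, hp⟩ := haugY (e.symm σ)
      refine ⟨p, ?_, by simp only [hp, MulEquiv.apply_symm_apply]⟩
      change δ₀ (T.augY p) = 1
      apply hj
      rw [hp, map_one]
      exact hσ
    · rintro ⟨p, hp, rfl⟩
      have hp' : δ₀ (T.augY p) = 1 := hp
      change j (δ₀ (e.symm (e (T.augY p)))) = 1
      rw [MulEquiv.symm_apply_apply, hp', map_one]
  have hopen1 : IsOpen {σ : L ≃ₐ[F] L | j (δ₀ (e.symm σ)) = 1} := by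
    rw [hset]
    exact hopen _ hU
  -- (4) Kummer theory at the cocycle level (Hilbert 90 + "`x^N` is a constant"; abc-iut-w5-d234's
  --     `AlgEquiv.exists_kummer_eq_of_isOpen`, consumed BY NAME): `c σ = σ(x)/x` with `x^N = a₀ ∈ F`
  have hN : ∀ z : T.mu, z ^ (𝔉.N : ℕ) = 1 := fun z => by
    rw [← T.card_mu]
    exact pow_card_eq_one
  obtain ⟨a₀, x, hxN, hx⟩ :=
    _root_.Literature.NumberTheory.GaloisRepresentations.AlgEquiv.exists_kummer_eq_of_isOpen (𝔉.N : ℕ)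
      (fun σ : L ≃ₐ[F] L => j (δ₀ (e.symm σ))) hcc hopen1 (fun σ => by
        rw [← map_pow, hN, map_one])
  have hx' : ∀ σ : L ≃ₐ[F] L, j (δ₀ (e.symm σ)) = σ • x / x := fun σ => hx σ
  -- (5) an `N`-th root `f ∈ (K^×)^{1/N}` of `a₀`; `x / ν f` is an `N`-th root of unity `j a`
  obtain ⟨f, hf⟩ := hνN a₀
  have hζ : (x * (ν f)⁻¹) ^ (𝔉.N : ℕ) = 1 := by
    rw [mul_pow, inv_pow, mul_inv_eq_one, hxN]
    exact Units.ext (by rw [Units.coe_map, MonoidHom.coe_coe, Units.val_pow_eq_pow_val, hf])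
  obtain ⟨a, ha⟩ := MonoidHom.mem_range.mp (hjN _ hζ)
  have hxe : x = j a * ν f := by rw [ha, inv_mul_cancel_right]
  refine ⟨f⁻¹, a⁻¹, fun p => hj ?_⟩
  -- (6) compare the two cocycles at `σ := e (aug p)`
  have lhs : j (δ₀ (T.augY p)) = e (T.augY p) • x / x := by
    rw [← hx' (e (T.augY p)), MulEquiv.symm_apply_apply]
  have hν' : e (T.augY p) • ν f =
      j (m (α.kummerCocycle hK f (𝔉.sgpCap (𝔉.ρ (ι.toMulEquiv.symm (p : T.PiX)))))) * ν f := by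
    have h := hνeq f (ι.toMulEquiv.symm (p : T.PiX))
    have e1 : ι (ι.toMulEquiv.symm (p : T.PiX)) = p := ι.toMulEquiv.apply_symm_apply _
    rw [e1] at h
    exact h.symm
  rw [lhs, map_mul, map_inv, kummerCocycleY_apply, α.kummerCocycle_inv_root hK, map_inv, map_inv, inv_inv]
  simp only [CycEnvelope.coboundary, map_mul, map_inv, inv_inv, hchi]
  rw [hxe, smul_mul', hν', ← mul_assoc, mul_div_mul_right_eq_div, div_eq_mul_inv]
  simp only [mul_assoc, mul_comm]

end Dictionary

/-! ### Lemma 5.9 (iv) at the honest `K^×`-part and at `DK₀`, the arithmetic inputs replaced by the dictionary -/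

section Assembly

variable (hK : 𝔉.KxRootNModCyclotome) (H : 𝔉.Facts) (h1 : 𝔉.SectionsFactor) (h3 : 𝔉.OuterActionLZ)
  (hsec : 𝔉.SgpCapSection) (hcs : 𝔉.SgpCupSection) (h8 : 𝔉.ConstantsEqNormalizer)
  (T : ThetaEnvData.{v} 𝔉.N) (ι : 𝔉.PiX ≃ₜ* T.PiX) (m : 𝔉.muTorsion 𝔉.BN 𝔉.N ≃* T.mu)
  (hY : 𝔉.IdentifiesPiY T ι.toMulEquiv) (hYdd : 𝔉.IdentifiesPiYdd T ι.toMulEquiv)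
  {F : Type*} {L : Type*} [Field F] [Field L] [Algebra F L]
  (e : T.G ≃* (L ≃ₐ[F] L)) (j : T.mu →* Lˣ) (ν : 𝔉.KxRootN →* Lˣ)

include hY in
/-- **[EtTh] Lemma 5.9 (iv) at the honest `K^×`-part `kummerOut`, arithmetic inputs FROM THE DICTIONARY**:
abc-iut-L2-t4's `EnvIsoBiTheta` at `DK := kummerOut` — as `envIsoBiTheta_birat_of_continuous` (abc-iut-L6-t23)
with `hχX`, `hinfl`, `hKumC` discharged by `cyclotomicCharacterCompatX_of_galoisDictionary`,
`hinfl_of_geometric ∘ hgeom_of_galoisDictionary`, `hKumC_of_hilbert90`.  Remaining hypotheses: the §5 named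
inputs, the identifications `ι`, `m`, `hY`, `hYdd`, the Prop. 5.2 (iii) dictionary `hcompat`,
`KxRootNModCyclotome`, and the Galois dictionary of the constants.
[cite: MochizukiEtTh2009, Lem 5.9 (iv) p.332 (PDF p.106)] -/
theorem envIsoBiTheta_birat_of_galoisDictionary [Normal F L] [NeZero ((𝔉.N : ℕ) : F)] (hj : Function.Injective j)
    (hjN : ∀ z : Lˣ, z ^ (𝔉.N : ℕ) = 1 → z ∈ j.range)
    (hchi : ∀ (g : T.G) (x : T.mu), j (T.chi g x) = e g • j x)
    (hνμ : ∀ u : 𝔉.muTorsion 𝔉.BN 𝔉.N, ν ⟨𝔉.muToBirat u, 𝔉.muToBirat_mem_KxRootN u⟩ = j (m u))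
    (hνeq : ∀ (f : 𝔉.KxRootN) (y : 𝔉.PiX),
      j (m (α.kummerCocycle hK f (𝔉.sgpCap (𝔉.ρ y)))) * ν f = e (T.aug (ι y)) • ν f)
    (hνN : ∀ y : Fˣ, ∃ f : 𝔉.KxRootN, ((ν f : Lˣ) : L) ^ (𝔉.N : ℕ) = algebraMap F L y)
    (haugY : Function.Surjective T.augY) (hopen : IsOpenMap fun p : T.PiY => e (T.augY p))
    {η : T.PiYdd → T.mu} (hη : η ∈ T.thetaCocycles)
    (hcompat : 𝔉.ThetaSectionCompat H T ι.toMulEquiv m hYdd η) :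
    𝔉.EnvIsoBiTheta h1 h3 hsec hcs h8 (α.kummerOut hK) T ι :=
  α.envIsoBiTheta_birat_of_continuous hK H h1 h3 hsec hcs h8 T ι m hY hYdd
    (α.cyclotomicCharacterCompatX_of_galoisDictionary hK T ι m e j ν hj hchi hνμ hνeq) hη hcompat
    (α.hinfl_of_geometric hK T ι m (α.hgeom_of_galoisDictionary hK T ι m e j ν hj hνeq))
    (α.hKumC_of_hilbert90 hK T ι m e j ν hj hjN hchi hνeq hνN haugY hopen)

include hY in
/-- **Lemma 5.9 (iv) "In particular" at the honest `K^×`-part, arithmetic inputs FROM THE DICTIONARY**: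
abc-iut-L2-t4's `FrdIsMonoThetaEnv` at `DK := kummerOut` (the binder `hM` of the [IUTchII] Prop. 1.2 (ii)
bridge).  [cite: MochizukiEtTh2009, Lem 5.9 (iv) p.332 (PDF p.106)] -/
theorem frdIsMonoThetaEnv_birat_of_galoisDictionary [Normal F L] [NeZero ((𝔉.N : ℕ) : F)]
    (hj : Function.Injective j) (hjN : ∀ z : Lˣ, z ^ (𝔉.N : ℕ) = 1 → z ∈ j.range)
    (hchi : ∀ (g : T.G) (x : T.mu), j (T.chi g x) = e g • j x)
    (hνμ : ∀ u : 𝔉.muTorsion 𝔉.BN 𝔉.N, ν ⟨𝔉.muToBirat u, 𝔉.muToBirat_mem_KxRootN u⟩ = j (m u))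
    (hνeq : ∀ (f : 𝔉.KxRootN) (y : 𝔉.PiX),
      j (m (α.kummerCocycle hK f (𝔉.sgpCap (𝔉.ρ y)))) * ν f = e (T.aug (ι y)) • ν f)
    (hνN : ∀ y : Fˣ, ∃ f : 𝔉.KxRootN, ((ν f : Lˣ) : L) ^ (𝔉.N : ℕ) = algebraMap F L y)
    (haugY : Function.Surjective T.augY) (hopen : IsOpenMap fun p : T.PiY => e (T.augY p))
    {η : T.PiYdd → T.mu} (hη : η ∈ T.thetaCocycles)
    (hcompat : 𝔉.ThetaSectionCompat H T ι.toMulEquiv m hYdd η) :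
    𝔉.FrdIsMonoThetaEnv h1 h3 hsec hcs h8 (α.kummerOut hK) T :=
  𝔉.frdIsMonoThetaEnv_of h1 h3 hsec hcs h8 (α.kummerOut hK) T ι
    (α.envIsoBiTheta_birat_of_galoisDictionary hK H h1 h3 hsec hcs h8 T ι m hY hYdd e j ν hj hjN hchi hνμ
      hνeq hνN haugY hopen hη hcompat)

/-- **Lemma 5.9 (iv) at the instance of record `DK₀`** (`Sec5BiThetaIsoCanonical.lean` /
`Sec5KummerOutCanonical.lean`, this seat), arithmetic inputs FROM THE DICTIONARY — here only `hχX` and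
`hgeom` enter, NOT Hilbert 90 (at `DK₀` the Kummer part is reached by definition).
[cite: MochizukiEtTh2009, Lem 5.9 (iv) p.332 (PDF p.106)] -/
theorem envIsoBiTheta_canonical_of_galoisDictionary (hj : Function.Injective j)
    (hchi : ∀ (g : T.G) (x : T.mu), j (T.chi g x) = e g • j x)
    (hνμ : ∀ u : 𝔉.muTorsion 𝔉.BN 𝔉.N, ν ⟨𝔉.muToBirat u, 𝔉.muToBirat_mem_KxRootN u⟩ = j (m u))
    (hνeq : ∀ (f : 𝔉.KxRootN) (y : 𝔉.PiX),
      j (m (α.kummerCocycle hK f (𝔉.sgpCap (𝔉.ρ y)))) * ν f = e (T.aug (ι y)) • ν f)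
    {η : T.PiYdd → T.mu} (hη : η ∈ T.thetaCocycles)
    (hcompat : 𝔉.ThetaSectionCompat H T ι.toMulEquiv m hYdd η) :
    𝔉.EnvIsoBiTheta h1 h3 hsec hcs h8
      (TopOut.transport (𝔉.envContIso H T ι m hY
        (α.cyclotomicCharacterCompatX_of_galoisDictionary hK T ι m e j ν hj hchi hνμ hνeq).toY) ⁻¹'
          T.kummerOut) T ι :=
  α.envIsoBiTheta_canonical_of_geometric hK H h1 h3 hsec hcs h8 T ι m hY hYdd
    (α.cyclotomicCharacterCompatX_of_galoisDictionary hK T ι m e j ν hj hchi hνμ hνeq) hη hcompat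
    (α.hgeom_of_galoisDictionary hK T ι m e j ν hj hνeq)

/-- … and its "In particular" (`FrdIsMonoThetaEnv` at `DK₀`) FROM THE DICTIONARY.
[cite: MochizukiEtTh2009, Lem 5.9 (iv) p.332 (PDF p.106)] -/
theorem frdIsMonoThetaEnv_canonical_of_galoisDictionary (hj : Function.Injective j)
    (hchi : ∀ (g : T.G) (x : T.mu), j (T.chi g x) = e g • j x)
    (hνμ : ∀ u : 𝔉.muTorsion 𝔉.BN 𝔉.N, ν ⟨𝔉.muToBirat u, 𝔉.muToBirat_mem_KxRootN u⟩ = j (m u))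
    (hνeq : ∀ (f : 𝔉.KxRootN) (y : 𝔉.PiX),
      j (m (α.kummerCocycle hK f (𝔉.sgpCap (𝔉.ρ y)))) * ν f = e (T.aug (ι y)) • ν f)
    {η : T.PiYdd → T.mu} (hη : η ∈ T.thetaCocycles)
    (hcompat : 𝔉.ThetaSectionCompat H T ι.toMulEquiv m hYdd η) :
    𝔉.FrdIsMonoThetaEnv h1 h3 hsec hcs h8
      (TopOut.transport (𝔉.envContIso H T ι m hY
        (α.cyclotomicCharacterCompatX_of_galoisDictionary hK T ι m e j ν hj hchi hνμ hνeq).toY) ⁻¹'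
          T.kummerOut) T :=
  𝔉.frdIsMonoThetaEnv_of h1 h3 hsec hcs h8 _ T ι
    (α.envIsoBiTheta_canonical_of_galoisDictionary hK H h1 h3 hsec hcs h8 T ι m hY hYdd e j ν hj hchi hνμ
      hνeq hη hcompat)

/-- **`D(kummerOut) = D(DK₀)` with the CONTINUOUS Kummer input**: as this seat's `D_kummerOut_eq`
(`Sec5KummerOutCanonical.lean`, gen 2) with `hKum` weakened to the continuous `hKumC` of abc-iut-L6-t23's
`Sec5KummerOutReachedContinuous.lean` (the only elements that must be reached are elements of `kummerOut(D_Y)`,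
which carry their continuity witness).  [cite: MochizukiEtTh2009, Lem 5.9 (iv) p.332 (PDF p.106)] -/
theorem D_kummerOut_eq_of_continuous (hχ : 𝔉.CyclotomicCharacterCompat T ι.toMulEquiv m)
    (hinfl : ∀ f : 𝔉.KxRootN, ∃ δ₀ : T.G → T.mu, ∀ (y : 𝔉.PiX), y ∈ 𝔉.PiY →
      m (α.kummerCocycle hK f (𝔉.sgpCap (𝔉.ρ y))) = δ₀ (T.aug (ι y)))
    (hKumC : ∀ (δ₀ : T.G → T.mu) (hδ : CycEnvelope.IsEnvCocycle T.augY T.chi (δ₀ ∘ T.augY)),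
      CycEnvelope.shift hδ ∈ contMulAut T.env →
      ∃ (f : 𝔉.KxRootN) (a : T.mu), ∀ p : T.PiY,
        δ₀ (T.augY p) = (α.kummerCocycleY hK f T ι.toMulEquiv m p)⁻¹ * CycEnvelope.coboundary T.augY T.chi a p) :
    (𝔉.frdBiThetaEnv h1 h3 hsec hcs h8 (α.kummerOut hK)).D =
      (𝔉.frdBiThetaEnv h1 h3 hsec hcs h8
        (TopOut.transport (𝔉.envContIso H T ι m hY hχ) ⁻¹' T.kummerOut)).D := by
  apply le_antisymm
  · exact Subgroup.closure_mono
      (Set.union_subset_union le_rfl (α.kummerOut_subset_preimage hK H T ι m hY hχ hinfl))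
  · change Subgroup.closure _ ≤ _
    rw [Subgroup.closure_le]
    rintro x (hx | hx)
    · exact Subgroup.subset_closure (Or.inl hx)
    · obtain ⟨y, hy, hyx⟩ := Subgroup.mem_map.mp
        (α.kummerOutReached_birat_of_continuous hK H T ι m hY hχ h1 h3 hsec hcs h8 hKumC hx)
      rw [← TopOut.transport_injective _ hyx]
      exact hy

/-- **`D(kummerOut) = D(DK₀)` FROM THE DICTIONARY**: the intrinsic `K^×`-part of Lemma 5.9 (iv) ("the natural
outer actions of `l·ℤ`, `K^×` [cf. Lemma 5.8] on `E_N`") and the instance of record `DK₀` generate the SAME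
`D ⊆ Out(E^Π_N)`, with no arithmetic hypothesis left besides the Galois dictionary of the constants — so every
certificate at `DK₀` (this seat's canonical Lemma 5.9 (iv); abc-iut-L6-t23's Theorem 5.10 (iii) at `DK₀`) is
one for print's `⟨l·ℤ, K^×⟩`-environment (transfer: abc-iut-w4-d095's `monoThetaEnvCompat_of_D_eq` /
`frdIsMonoThetaEnv_of_D_eq`).  [cite: MochizukiEtTh2009, Lem 5.9 (iv) p.332 (PDF p.106)] -/
theorem D_kummerOut_eq_of_galoisDictionary [Normal F L] [NeZero ((𝔉.N : ℕ) : F)] (hj : Function.Injective j)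
    (hjN : ∀ z : Lˣ, z ^ (𝔉.N : ℕ) = 1 → z ∈ j.range)
    (hchi : ∀ (g : T.G) (x : T.mu), j (T.chi g x) = e g • j x)
    (hνμ : ∀ u : 𝔉.muTorsion 𝔉.BN 𝔉.N, ν ⟨𝔉.muToBirat u, 𝔉.muToBirat_mem_KxRootN u⟩ = j (m u))
    (hνeq : ∀ (f : 𝔉.KxRootN) (y : 𝔉.PiX),
      j (m (α.kummerCocycle hK f (𝔉.sgpCap (𝔉.ρ y)))) * ν f = e (T.aug (ι y)) • ν f)
    (hνN : ∀ y : Fˣ, ∃ f : 𝔉.KxRootN, ((ν f : Lˣ) : L) ^ (𝔉.N : ℕ) = algebraMap F L y)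
    (haugY : Function.Surjective T.augY) (hopen : IsOpenMap fun p : T.PiY => e (T.augY p)) :
    (𝔉.frdBiThetaEnv h1 h3 hsec hcs h8 (α.kummerOut hK)).D =
      (𝔉.frdBiThetaEnv h1 h3 hsec hcs h8
        (TopOut.transport (𝔉.envContIso H T ι m hY
          (α.cyclotomicCharacterCompatX_of_galoisDictionary hK T ι m e j ν hj hchi hνμ hνeq).toY) ⁻¹'
            T.kummerOut)).D :=
  α.D_kummerOut_eq_of_continuous hK H h1 h3 hsec hcs h8 T ι m hY _
    (α.hinfl_of_geometric hK T ι m (α.hgeom_of_galoisDictionary hK T ι m e j ν hj hνeq))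
    (α.hKumC_of_hilbert90 hK T ι m e j ν hj hjN hchi hνeq hνN haugY hopen)

end Assembly

end BiratAutAction

end ThetaFrobenioid

end Literature.AnabelianGeometry.EtaleTheta

end
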